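import Summits.Ventures.HodgeRepro2.T5SU11JacobiWeight
import Summits.Ventures.HodgeRepro2.T5SU11CoeffSqCartan

/-!
# The law of the orbit point under `m_k φ_λ dν` is rotation-invariant: the angle is uniform and
independent of the radius

The integrand `m_k φ_λ` is left-`K`-invariant (`m_k(rot u · g) = m_k(g)`, `φ_λ(rot u · g) = φ_λ(g)`), the Haar
measure `ν` is left-invariant (`T5SU11FibrationHaar`), and the orbit point rotates under `K`:
`(rot u · g)·0 = u² · (g·0)` (`T5SU11CoeffSqCartan.orbit_rot_mul`). Hence, for every measurable set
`A ⊂ ℂ` and every rotation `w = u²` (every rotation is a square, `w = Circle.exp θ = Circle.exp (θ/2)²`),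

  **`∫_{w·(g·0) ∈ A} m_k φ_λ dν = ∫_{g·0 ∈ A} m_k φ_λ dν`**   (`integral_orbit_rot_sq_eq`, `integral_orbit_rot_eq`)

— the law of the orbit point `g·0 ∈ 𝔻` under the probability measure `m_k φ_λ dν / m̂_k(λ)` is invariant
under all rotations of the disc, for every weight and every spectral parameter: its angular part is
uniform and independent of the radial part, whose law is the subject of `T5SU11OrbitRadiusLaw`,
`T5SU11JacobiPhaseMGF`, `T5SU11JacobiOrbitMoments` and `T5SU11JacobiOrbitLawAsymptotic`. The same holds
for the phase-and-angle pair, since the phase `log|a(g)|` is a function of `|g·0|` (`phase_rot_mul`).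
No integrability is needed (the Bochner integrals of non-integrable functions are `0` on both sides).
Nothing is claimed about (N).

Blind lane: Mathlib + the HodgeRepro2 prefix only; no sorry; axioms ⊆ {propext, Classical.choice,
Quot.sound}.
-/

namespace Summit.Ventures.HodgeRepro2.T5SU11JacobiOrbitRotationLaw

open MeasureTheory MeasureTheory.Measure Metric Set Filter Topology
open T5SU11Unimodular T5SU11Fibration T5SU11Cartan T5HaarCircle T5BergmanCoefficient
  T5SU11FibrationHaar T5SU11SphericalFunction T5SU11SphericalSymmetry T5SU11SphericalBounds
  T5SU11SphericalContinuous T5SU11JacobiIwasawa T5SU11JacobiTransform T5SU11JacobiWeight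
  T5SU11KFiniteMajorantPow T5SU11OrbitMeasure T5SU11CoeffSqCartan
open scoped Real

/-- The phase is left-`K`-invariant: `log|a(rot u · g)| = log|a(g)|` (`|a|² = (1 − |g·0|²)⁻¹`). -/
theorem phase_rot_mul (u : Circle) (g : SU11) :
    Real.log ‖mat (rot u * g) 0 0‖ = Real.log ‖mat g 0 0‖ := by
  have h := orbit_rpow_eq_exp 1 (rot u * g)
  rw [norm_orbit_rot_mul, orbit_rpow_eq_exp 1 g] at h
  have := Real.exp_injective h
  linarith

section measure

variable [MeasurableSpace Circle] [BorelSpace Circle]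

/-- **Rotation invariance of the orbit law (squares)**: for every measurable `A ⊂ ℂ`, `u ∈ Circle`, `k`, `λ`,
`∫_{u²·(g·0) ∈ A} m_k φ_λ dν = ∫_{g·0 ∈ A} m_k φ_λ dν`. -/
theorem integral_orbit_rot_sq_eq (k lam : ℝ) (u : Circle) {A : Set ℂ} (hA : MeasurableSet A) :
    ∫ g in {g : SU11 | (u : ℂ) ^ 2 * orbit g ∈ A}, (1 - ‖orbit g‖ ^ 2) ^ (k / 2) * sph lam g ∂(nu haarCircle)
      = ∫ g in {g : SU11 | orbit g ∈ A}, (1 - ‖orbit g‖ ^ 2) ^ (k / 2) * sph lam g ∂(nu haarCircle) := by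
  have hS1 : MeasurableSet {g : SU11 | (u : ℂ) ^ 2 * orbit g ∈ A} :=
    (continuous_const.mul continuous_orbit).measurable hA
  have hS2 : MeasurableSet {g : SU11 | orbit g ∈ A} := continuous_orbit.measurable hA
  rw [← integral_indicator hS1, ← integral_indicator hS2]
  -- left-translate by `rot u`: `ν` is left-invariant
  rw [← integral_mul_left_eq_self (fun g => {g : SU11 | orbit g ∈ A}.indicator
    (fun g => (1 - ‖orbit g‖ ^ 2) ^ (k / 2) * sph lam g) g) (rot u)]
  refine integral_congr_ae (Filter.Eventually.of_forall fun g => ?_)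
  simp only
  by_cases hg : g ∈ {g : SU11 | (u : ℂ) ^ 2 * orbit g ∈ A}
  · have hg' : rot u * g ∈ {g : SU11 | orbit g ∈ A} := by
      show orbit (rot u * g) ∈ A
      rw [orbit_rot_mul]
      exact hg
    rw [indicator_of_mem hg, indicator_of_mem hg', orbit_rpow_rot_mul, sph_rot_mul]
  · have hg' : rot u * g ∉ {g : SU11 | orbit g ∈ A} := by
      show ¬ orbit (rot u * g) ∈ A
      rw [orbit_rot_mul]
      exact hg
    rw [indicator_of_notMem hg, indicator_of_notMem hg']

/-- **Rotation invariance of the orbit law (all rotations)**: for every angle `θ`,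
`∫_{e^{iθ}·(g·0) ∈ A} m_k φ_λ dν = ∫_{g·0 ∈ A} m_k φ_λ dν`. -/
theorem integral_orbit_rot_eq (k lam θ : ℝ) {A : Set ℂ} (hA : MeasurableSet A) :
    ∫ g in {g : SU11 | Complex.exp (θ * Complex.I) * orbit g ∈ A},
        (1 - ‖orbit g‖ ^ 2) ^ (k / 2) * sph lam g ∂(nu haarCircle)
      = ∫ g in {g : SU11 | orbit g ∈ A}, (1 - ‖orbit g‖ ^ 2) ^ (k / 2) * sph lam g ∂(nu haarCircle) := by
  have e : Complex.exp (θ * Complex.I) = ((Circle.exp (θ / 2) : Circle) : ℂ) ^ 2 := by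
    rw [Circle.coe_exp, ← Complex.exp_nat_mul]
    congr 1
    push_cast
    ring
  rw [e]
  exact integral_orbit_rot_sq_eq k lam (Circle.exp (θ / 2)) hA

/-- The normalised form: the `m_k φ_λ dν/m̂_k(λ)`-probability of `{e^{iθ}·(g·0) ∈ A}` equals that of
`{g·0 ∈ A}`. -/
theorem prob_orbit_rot_eq (k lam θ : ℝ) {A : Set ℂ} (hA : MeasurableSet A) :
    (∫ g in {g : SU11 | Complex.exp (θ * Complex.I) * orbit g ∈ A},
        (1 - ‖orbit g‖ ^ 2) ^ (k / 2) * sph lam g ∂(nu haarCircle))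
      / ∫ g, (1 - ‖orbit g‖ ^ 2) ^ (k / 2) * sph lam g ∂(nu haarCircle)
      = (∫ g in {g : SU11 | orbit g ∈ A}, (1 - ‖orbit g‖ ^ 2) ^ (k / 2) * sph lam g ∂(nu haarCircle))
        / ∫ g, (1 - ‖orbit g‖ ^ 2) ^ (k / 2) * sph lam g ∂(nu haarCircle) := by
  rw [integral_orbit_rot_eq k lam θ hA]

end measure

end Summit.Ventures.HodgeRepro2.T5SU11JacobiOrbitRotationLaw
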